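import Summits.QuantumFields.Balaban3D.Carriers.Group
import Literature.MathematicalPhysics.QuantumFieldTheory.Balaban1983to89.AveragingRT
import Literature.MathematicalPhysics.QuantumFieldTheory.Balaban1983to89.BlockAveragingExpMeanLogContinuous
import Literature.MeasureTheory.RandomSets.MeasurableConstrainedArgmin

/-!
# Route «BalabanUVNodes», Track-A DAG node N08 = [Balaban1985UV3] — (α) clause, face `measUk`, part 1 of 2: THE TOPOLOGY OF A GROUP AS PRINTED
# and the continuity of the printed maps on the configuration spaces

Cell `pub-ymgap`, seat `pub-ymgap-dag-n08-d` gen 4, file 1a (director-ym R134 row «CLASS-I in-edge conclusions at the (α) granularity of `RunAlpha`: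
… discharge the species-OK interfaces `h68 ∕ hU ∕ h44 ∕ hLF67`»; located item L2 of `HOME/pub-ymgap-dag-n08-d/N08-ALPHA-LOCATED-g3.md`: the face
`measUk` «needs a topology on G + a constructed minimizer … with G's topology via `GroupModel.ρ`»).  `bears_on: R4∕N08`; filed
`--supports stmt-QuantumFields-19903 --as helper`.  Sorry-free, standard axioms.  Part 2 (`BalabanUVNodesN08AlphaMeasUk`) does the selection.

WHY.  The d = 3 lane's END theorem `UVStability3DInputs.uvStability3D_of_inputs` quantifies over a BARE group as printed
`(G : Type) [GaugeGroup G] [MeasurableSpace G] [HaarData G] (𝔊 : Setting.GroupModel G)` — no topology.  Every topological statement about print's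
objects at that granularity (compactness of the configuration spaces `G^{bonds}`, continuity of the Wilson action [7] (5) and of the averaging maps
of [4], openness of the small-plaquette classes [7] (2), hence measurable selection of the (42)-minimisers — part 2) needs THE topology of `G`: the one
induced along the faithful unitary realisation `ρ : G →* M_N(ℂ)` of the model.  This file supplies it, with the facts that make it canonical.

WHAT THIS FILE PROVES (kernel; [folklore] topology over the tree's own objects):
* §1 `rhoTopology 𝔊 := induced ρ` (an `abbrev`, used through `letI`; not an instance — `G` is a bound variable of the lane).  In it: `ρ` is a closed
  embedding (`isClosedEmbedding_rho`; `GroupModel.injective`, `GroupModel.isClosed_range`), `G` is COMPACT (`compactSpace_rho`: closed in the compact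
  `U(N)`, tree `Matrix.unitaryGroup.instCompactSpace`), second countable, POLISH (`polishSpace_rho`), its Borel σ-algebra IS THE GIVEN measurable
  structure (`borelSpace_rho`: `GroupModel.measurableSpace_eq` + Mathlib `borel_comap`), a TOPOLOGICAL GROUP (`isTopologicalGroup_rho`: `ρ` a
  homomorphism, `ρ(g⁻¹) = ρ(g)ᴴ`), and `|· − 1|`, `Re tr` ((4), (1) p. 256) are continuous (`continuous_dist1_rho`, `continuous_reTr_rho`).
* §2 over any topological group: bond and plaquette variables, the Wilson action `Setup.wilsonAction` ([7] (5)), the transports `AveragingRT.pathProd`,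
  the axial ∕ transport ∕ standard averaging maps `axialAvg ∕ transportAvg ∕ stdAvg` (the lane's `Carriers.ExternalInputs.ofStd` family) and the
  iterates `Averaging.iter` are continuous (σ-closed-continuous iterates ∕ joint map for part 2's selection theorem); the small-plaquette classes
  `{U | |U(∂p) − 1| < ε_p, p ∈ F}` ([7] (2)) are open.
HONEST FRAMING: count-neutral bookkeeping; nothing of [B10] ∕ [7] ∕ [4] is asserted; NOT a discharge of N08.  d = 3 lattice gauge theory on finite tori
as printed; nothing about d = 4, the continuum, OS axioms, a mass gap or the Clay problem.
-/

noncomputable section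

namespace Summit.QuantumFields.YangMills.Theorems.BalabanUVNodesN08AlphaGroupTopology

open MeasureTheory Set Topology TopologicalSpace
open scoped Matrix
open Literature.MeasureTheory.RandomSets
open Literature.MathematicalPhysics.QuantumFieldTheory.Balaban1983to89
open Literature.MathematicalPhysics.QuantumFieldTheory.Balaban1983to89.AveragingRT (pathProd axialAvg axial axial_avg transportAvg stdAvg)
open Literature.MathematicalPhysics.QuantumFieldTheory.Balaban1985CMP102.Setting

/-! ## §1 The topology of a group as printed -/

section GroupTopology

variable {G : Type} [GaugeGroup G] [MeasurableSpace G]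

/-- **THE TOPOLOGY OF A GROUP AS PRINTED**: the topology of `G` induced along its faithful unitary realisation `ρ : G →* M_N(ℂ)` («a Lie subgroup G
of a unitary group U(N)», [4] p. 18; «compact», [Balaban1985UV3] Thm 1 p. 257).  Not an instance (the lane's `G` is a bound variable); used through
`letI`. [cite: Balaban1985UV3, Thm 1 p.257] -/
abbrev rhoTopology (𝔊 : GroupModel G) : TopologicalSpace G :=
  TopologicalSpace.induced 𝔊.ρ inferInstance

variable (𝔊 : GroupModel G)

/-- `ρ` induces the topology (by definition). [folklore] -/
theorem isInducing_rho : letI := rhoTopology 𝔊; IsInducing 𝔊.ρ := by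
  letI := rhoTopology 𝔊
  exact ⟨rfl⟩

/-- `ρ` is continuous. [folklore] -/
theorem continuous_rho : letI := rhoTopology 𝔊; Continuous 𝔊.ρ := by
  letI := rhoTopology 𝔊
  exact continuous_induced_dom

/-- `ρ` is an embedding (inducing and faithful). [folklore] -/
theorem isEmbedding_rho : letI := rhoTopology 𝔊; IsEmbedding 𝔊.ρ := by
  letI := rhoTopology 𝔊
  exact ⟨isInducing_rho 𝔊, 𝔊.injective⟩

/-- `ρ` is a closed embedding (its range is closed, `GroupModel.isClosed_range`). [folklore] -/
theorem isClosedEmbedding_rho : letI := rhoTopology 𝔊; IsClosedEmbedding 𝔊.ρ := by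
  letI := rhoTopology 𝔊
  exact ⟨isEmbedding_rho 𝔊, 𝔊.isClosed_range⟩

/-- The range of `ρ` is compact: a closed subset of the compact unitary group `U(N)` (tree `Matrix.unitaryGroup.instCompactSpace`). [folklore] -/
theorem isCompact_range_rho : IsCompact (Set.range 𝔊.ρ) := by
  have hU : IsCompact (Matrix.unitaryGroup (Fin 𝔊.N) ℂ : Set (Matrix (Fin 𝔊.N) (Fin 𝔊.N) ℂ)) :=
    isCompact_iff_compactSpace.mpr Matrix.unitaryGroup.instCompactSpace
  refine hU.of_isClosed_subset 𝔊.isClosed_range ?_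
  rintro _ ⟨g, rfl⟩
  exact 𝔊.mem_unitary g

/-- **A group as printed is COMPACT** in the topology of its realisation. [cite: Balaban1985UV3, Thm 1 p.257] -/
theorem compactSpace_rho : letI := rhoTopology 𝔊; CompactSpace G := by
  letI := rhoTopology 𝔊
  refine ⟨(isInducing_rho 𝔊).isCompact_iff.mpr ?_⟩
  rw [Set.image_univ]
  exact isCompact_range_rho 𝔊

/-- A group as printed is second countable (embedded in `M_N(ℂ)`). [folklore] -/
theorem secondCountableTopology_rho : letI := rhoTopology 𝔊; SecondCountableTopology G := by
  letI := rhoTopology 𝔊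
  haveI := secondCountableTopology_matrix (n := Fin 𝔊.N)
  exact (isEmbedding_rho 𝔊).secondCountableTopology

/-- **A group as printed is POLISH** (a closed subspace of `M_N(ℂ)`). [folklore] -/
theorem polishSpace_rho : letI := rhoTopology 𝔊; PolishSpace G := by
  letI := rhoTopology 𝔊
  haveI : PolishSpace (Matrix (Fin 𝔊.N) (Fin 𝔊.N) ℂ) := inferInstanceAs (PolishSpace (Fin 𝔊.N → Fin 𝔊.N → ℂ))
  exact (isClosedEmbedding_rho 𝔊).polishSpace

/-- **THE GIVEN σ-ALGEBRA OF A GROUP AS PRINTED IS THE BOREL σ-ALGEBRA of the topology of its realisation** (`GroupModel.measurableSpace_eq`: it is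
the pull-back of the Borel σ-algebra of `M_N(ℂ)` along `ρ`; Mathlib `borel_comap`). [folklore] -/
theorem borelSpace_rho : letI := rhoTopology 𝔊; BorelSpace G := by
  letI := rhoTopology 𝔊
  exact ⟨𝔊.measurableSpace_eq.trans borel_comap.symm⟩

/-- Multiplication is continuous (`ρ` is a homomorphism into the topological ring `M_N(ℂ)`). [folklore] -/
theorem continuousMul_rho : letI := rhoTopology 𝔊; ContinuousMul G := by
  letI := rhoTopology 𝔊
  refine ⟨(isInducing_rho 𝔊).continuous_iff.mpr ?_⟩
  have hfun : (𝔊.ρ ∘ fun p : G × G => p.1 * p.2) = fun p => 𝔊.ρ p.1 * 𝔊.ρ p.2 := by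
    funext p
    simp only [Function.comp_apply, map_mul]
  rw [hfun]
  exact ((continuous_rho 𝔊).comp continuous_fst).mul ((continuous_rho 𝔊).comp continuous_snd)

/-- Inversion is continuous (`ρ(g⁻¹) = ρ(g)ᴴ`). [folklore] -/
theorem continuousInv_rho : letI := rhoTopology 𝔊; ContinuousInv G := by
  letI := rhoTopology 𝔊
  refine ⟨(isInducing_rho 𝔊).continuous_iff.mpr ?_⟩
  have hfun : (𝔊.ρ ∘ fun g : G => g⁻¹) = fun g => (𝔊.ρ g)ᴴ := by
    funext g
    exact UnitaryModel.map_inv_eq_conjTranspose 𝔊.ρ 𝔊.mem_unitary g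
  rw [hfun]
  exact (continuous_rho 𝔊).matrix_conjTranspose

/-- **A group as printed is a TOPOLOGICAL GROUP** in the topology of its realisation. [folklore] -/
theorem isTopologicalGroup_rho : letI := rhoTopology 𝔊; IsTopologicalGroup G := by
  letI := rhoTopology 𝔊
  haveI := continuousMul_rho 𝔊
  haveI := continuousInv_rho 𝔊
  exact {}

/-- `|· − 1|` ((4) p. 256; the operator-norm distance of the model) is continuous. [folklore] -/
theorem continuous_dist1_rho : letI := rhoTopology 𝔊; Continuous (dist1 : G → ℝ) := by
  letI := rhoTopology 𝔊
  have hfun : (dist1 : G → ℝ) = UnitaryModel.opDist1 ∘ 𝔊.ρ := funext 𝔊.dist1_eq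
  rw [hfun]
  exact UnitaryModel.continuous_opDist1.comp (continuous_rho 𝔊)

/-- `Re tr` ((1), (5) p. 256; the normalised real trace of the model) is continuous. [folklore] -/
theorem continuous_reTr_rho : letI := rhoTopology 𝔊; Continuous (reTr : G → ℝ) := by
  letI := rhoTopology 𝔊
  have hfun : (reTr : G → ℝ) = UnitaryModel.nReTr ∘ 𝔊.ρ := funext 𝔊.reTr_eq
  rw [hfun]
  exact UnitaryModel.continuous_nReTr.comp (continuous_rho 𝔊)

end GroupTopology

/-! ## §2 Configuration spaces over a topological group: continuity of the printed maps -/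

section Configurations

variable {P : Params} {j : ℕ} {G : Type*} [GaugeGroup G] [TopologicalSpace G]

omit [GaugeGroup G] in
/-- A bond variable is a continuous function of the configuration (product topology). [folklore] -/
theorem continuous_applyBond (b : PBond P j) : Continuous fun U : GaugeField P j G => U b :=
  continuous_apply b

/-- Plaquette variables `U(∂p)` are continuous in the configuration. [folklore] -/
theorem continuous_plaqHol [ContinuousMul G] [ContinuousInv G] (p : Plaq P j) :
    Continuous fun U : GaugeField P j G => GaugeField.plaqHol U p := by
  have hb : ∀ b : PBond P j, Continuous fun U : GaugeField P j G => U b := fun b => continuous_apply b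
  unfold GaugeField.plaqHol
  exact (((hb _).mul (hb _)).mul (hb _).inv).mul (hb _).inv

/-- The Wilson action `Σ_p w[1 − Re tr U(∂p)]` (`Setup.wilsonAction`; [7] (5) «A^η(U) = Σ_{p⊂Ω₀} η^{d−4}[1 − Re tr U(∂p)]») is continuous once
`Re tr` is. [cite: Balaban1985Variational, (5) p.278] -/
theorem continuous_wilsonAction [ContinuousMul G] [ContinuousInv G] (hreTr : Continuous (reTr : G → ℝ)) (w : ℝ) :
    Continuous (wilsonAction w : GaugeField P j G → ℝ) := by
  unfold wilsonAction
  exact continuous_finsetSum _ fun p _ =>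
    continuous_const.mul (continuous_const.sub (hreTr.comp (continuous_plaqHol p)))

/-- The small-plaquette class `{U | |U(∂p) − 1| < ε_p for p ∈ F}` ([7] (2) «U_k({Ω_j}, ε₀)») is OPEN once `|· − 1|` is continuous. [cite: Balaban1985Variational, (2) p.278] -/
theorem isOpen_plaqSmallClass [ContinuousMul G] [ContinuousInv G] (hdist : Continuous (dist1 : G → ℝ)) (F : Set (Plaq P j))
    (ε : Plaq P j → ℝ) : IsOpen {U : GaugeField P j G | ∀ p ∈ F, dist1 (GaugeField.plaqHol U p) < ε p} := by
  have h : {U : GaugeField P j G | ∀ p ∈ F, dist1 (GaugeField.plaqHol U p) < ε p} =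
      ⋂ p ∈ F, {U | dist1 (GaugeField.plaqHol U p) < ε p} := by
    ext U
    simp only [mem_setOf_eq, mem_iInter]
  rw [h]
  exact (Set.toFinite F).isOpen_biInter fun p _ => isOpen_lt (hdist.comp (continuous_plaqHol p)) continuous_const

/-- The transports `U(b₀)⋯U(b_{n−1})` along the line of a coarse bond are continuous. [folklore] -/
theorem continuous_pathProd [ContinuousMul G] (c : PBond P (j + 1)) : ∀ n : ℕ, Continuous fun U : GaugeField P j G => pathProd U c n
  | 0 => by
    simp only [pathProd]
    exact continuous_const
  | n + 1 => by
    simp only [pathProd]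
    exact (continuous_pathProd c n).mul (continuous_apply _)

/-- The axial average `Ū(c) = U(Γ_c)` is continuous (any topological group; the tree's `continuous_axialAvg` is the `SU(N)` case). [folklore] -/
theorem continuous_axialAvg_of_continuousMul [ContinuousMul G] :
    Continuous (axialAvg : GaugeField P j G → GaugeField P (j + 1) G) :=
  continuous_pi fun c => continuous_pathProd c P.L

omit [GaugeGroup G] in
/-- The label transport beyond the coarsest level is continuous (a relabelling). [folklore] -/
theorem continuous_transportAvg (hj : P.m + P.K ≤ j) : Continuous (transportAvg hj : GaugeField P j G → GaugeField P (j + 1) G) :=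
  continuous_pi fun _ => continuous_apply _

/-- **The lane's standard averaging family `AveragingRT.stdAvg` is continuous at every level** (axial in the standing range, transport beyond).
[folklore] -/
theorem continuous_stdAvg [ContinuousMul G] (k : ℕ) : Continuous (stdAvg P G k).avg := by
  by_cases hk : k + 1 ≤ P.m + P.K
  · have h : (stdAvg P G k).avg = (axial : Averaging P k G).avg := by simp only [stdAvg, dif_pos hk]
    rw [h, axial_avg]
    exact continuous_axialAvg_of_continuousMul
  · have hk' : P.m + P.K ≤ k := by omega
    have h : (stdAvg P G k).avg = transportAvg hk' := by simp only [stdAvg, dif_neg hk]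
    rw [h]
    exact continuous_transportAvg hk'

/-- Iterates `Ū^k` of a family of continuous averaging maps are continuous. [folklore] -/
theorem continuous_iter {av : ∀ j, Averaging P j G} (h : ∀ j, Continuous (av j).avg) : ∀ k : ℕ, Continuous (Averaging.iter av k)
  | 0 => continuous_id
  | k + 1 => (h k).comp (continuous_iter h k)

/-- Iterates `Ū^k` of a family of σ-closed-continuous averaging maps are σ-closed-continuous (composition). [folklore] -/
theorem sigmaClosedContinuous_iter {av : ∀ j, Averaging P j G} (h : ∀ j, SigmaClosedContinuous (av j).avg) :
    ∀ k : ℕ, SigmaClosedContinuous (Averaging.iter av k)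
  | 0 => SigmaClosedContinuous.of_continuous continuous_id
  | k + 1 => (h k).comp (sigmaClosedContinuous_iter h k)

/-- The joint map `U ↦ (Ū^j)_{j ≤ k}` is σ-closed-continuous (finite product). [folklore] -/
theorem sigmaClosedContinuous_iterUpTo {av : ∀ j, Averaging P j G} (h : ∀ j, SigmaClosedContinuous (av j).avg) (k : ℕ) :
    SigmaClosedContinuous fun (U : GaugeField P 0 G) (j : Fin (k + 1)) => Averaging.iter av j U :=
  SigmaClosedContinuous.pi fun j => sigmaClosedContinuous_iter h j

end Configurations
end Summit.QuantumFields.YangMills.Theorems.BalabanUVNodesN08AlphaGroupTopology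

end
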